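import Summits.AtomisticToContinuum.HydrodynamicLimit.Theorems.InformationPercolationEngineChaosClosesEulerShellPointwise
import Summits.AtomisticToContinuum.HydrodynamicLimit.Theorems.InformationPercolationEngineChaosClosesEulerShellMonatomic
import Literature.Analysis.FluidPDE.MVWeakStrongDefs
import HarnessLib

/-!
# BF18 shell for functions (crux `ChaosClosesEuler`, stmt-AtomisticToContinuum-15141, line `Sketch`,
# stub `stub_bf18Shell`) — helper 3d: the pointwise master step for admissible shell states

WHAT. `stub_bf18ShellRHS`: the deterministic BF18 relative-energy shell (Březina–Feireisl 2018, §3, re-run for a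
GENUINE bounded field) works with shell states `U = (ϱ, m, E)` — density `ϱ ≥ 0`, momentum `m`, TOTAL energy
`E ≥ 0`, admissible `‖m‖² ≤ 2ϱE` — mapped to the phase points `w(U) = (ϱ, E_int, m)`,
`E_int = E − ‖m‖²/(2ϱ)` (so `E_int = E`, `m = 0` on the vacuum), against the monatomic excess equation of state
`eos = EulerEOS.monatomicExcess χ f` (`p = ρϑχ(ρ)`, `e = 3ϑ/2`), with the entropy cut-off SELECTED by the state:
`clamp a b` on warm states (`ϑ = 2/3 (E/ϱ − ‖m‖²/(2ϱ²)) > 0`), the constant value `a` on cold (`ϱ > 0`, `ϑ ≤ 0`,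
forcing `E_int = 0`) and vacuum states. For reference states in a compact `K ⊂ (0,∞)²` and strong data bounded by
`M` there are `δ > 0`, levels `a < b` and constants `C, c > 0` with

* `rawRHS + div(p̃U) ≤ C · ℰ_Z` (BF (3.5)+(3.7) → (3.11), pointwise) for every admissible shell state;
* `0 ≤ ℰ_Z`;
* near coercivity `c((ϱ−r)² + (ϑ−Θ)²) + |m − ϱU|²/(2ϱ) ≤ ℰ_Z` on the `δ`-boxes (`ϱ > 0`);
* far coercivity `c(1 + ϱ + E + |m − ϱU|²/(2ϱ)) ≤ ℰ_Z` off the boxes, with the TOTAL energy `E`.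

WHY. Everything is read off the landed package `clamped_pointwise_package` (helper 3b), whose equation-of-state
hypotheses for the monatomic class are `monatomicExcess_bf_hypotheses` and the facts of helper 3c. Warm states
(`ϱ > 0`, `E_int = 3ϱϑ/2 > 0`): the quadrant clauses plus the tree identity `rawRHS_add_div_eq`
(`rawRHS + div(p̃U) = reducedRHS`, BF Step 1). Cold states: `0 ≤ E_int ≤ 0`, the cold clause with the value `a`.
Vacuum: `m = 0` by admissibility, `rawRHS = ∂ₜp̃` since `p(0,·) = 0`, and `reducedRHS_vacuum`. The passage from
the internal to the total energy in the far clause costs the factor `3 + 3M²`: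
`‖m‖²/(2ϱ) ≤ 2·|m − ϱU|²/(2ϱ) + 3M²ϱ` (`|Uᵢ| ≤ M`), so the coercivity constant is `c/(3 + 3M²)`.

No named fact is invoked.
-/

noncomputable section

namespace Summit.AtomisticToContinuum.HydrodynamicLimit.Theorems.ChaosClosesEulerShellRHS

open Set Literature.Analysis.FluidPDE Literature.Analysis.FluidPDE.CompressibleEuler
open Literature.Analysis.FluidPDE.CompressibleEuler.StrongPointData
open Literature.Analysis.FluidPDE.CompressibleEuler.EulerPhase
open Literature.Analysis.FluidPDE.CompressibleEuler.EulerEOS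
open Summit.AtomisticToContinuum.HydrodynamicLimit.Theorems.ChaosClosesEulerShell
open scoped BigOperators

variable {χe f : ℝ → ℝ}

/-- The temperature of the phase point of a shell state: `ϑ(ϱ, E − ‖m‖²/(2ϱ)) = 2/3 (E/ϱ − ‖m‖²/(2ϱ²))`
(both sides vanish on the vacuum by the junk conventions). [folklore] -/
theorem stateTemp_shell (ϱ E : ℝ) (m : EuclideanSpace ℝ (Fin 3)) :
    stateTemp (EulerEOS.monatomicExcess χe f) ϱ (E - ‖m‖ ^ 2 / (2 * ϱ)) =
      2 / 3 * (E / ϱ - ‖m‖ ^ 2 / (2 * ϱ ^ 2)) := by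
  rw [monatomicExcess_stateTemp]
  rcases eq_or_ne ϱ 0 with h | h
  · subst h; simp
  · field_simp

/-- On the vacuum the raw right-hand side (BF (3.5)) reduces to `∂ₜ p(r,Θ)`, for every cut-off, since
`p(0,·) = 0`. [folklore] -/
theorem rawRHS_vacuum (Z : ℝ → ℝ) (d : StrongPointData) (E : ℝ) :
    rawRHS (EulerEOS.monatomicExcess χe f) Z d 0 E 0 = d.pt (EulerEOS.monatomicExcess χe f) := by
  unfold rawRHS
  simp [monatomicExcess_p_vacuum]

/-- **From internal to total energy in the far coercivity.** For `ϱ > 0`, `E_int ≥ 0`, `|Uᵢ| ≤ M` and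
`E = E_int + ‖m‖²/(2ϱ)`: `1 + ϱ + E + |m − ϱU|²/(2ϱ) ≤ (3 + 3M²)(1 + ϱ + E_int + |m − ϱU|²/(2ϱ))`, from
`mᵢ² ≤ 2(mᵢ − ϱUᵢ)² + 2ϱ²Uᵢ²`. [folklore] -/
theorem far_transfer {M : ℝ} {d : StrongPointData} (hB : d.Bounded M)
    {ϱ Ei E : ℝ} (hϱ : 0 < ϱ) (hEi : 0 ≤ Ei) (m : EuclideanSpace ℝ (Fin 3))
    (hE : E = Ei + ‖m‖ ^ 2 / (2 * ϱ)) :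
    1 + ϱ + E + (∑ i, (m i - ϱ * d.U i) ^ 2) / (2 * ϱ) ≤
      (3 + 3 * M ^ 2) * (1 + ϱ + Ei + (∑ i, (m i - ϱ * d.U i) ^ 2) / (2 * ϱ)) := by
  have hU : ∀ i, d.U i ^ 2 ≤ M ^ 2 := fun i => by
    rw [← sq_abs (d.U i)]
    exact pow_le_pow_left₀ (abs_nonneg _) (hB.2.2.1 i) 2
  have hmi : ∀ i, m i ^ 2 ≤ 2 * (m i - ϱ * d.U i) ^ 2 + 2 * ϱ ^ 2 * M ^ 2 := fun i => by
    nlinarith [sq_nonneg (m i - 2 * ϱ * d.U i), hU i, sq_nonneg ϱ]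
  have hm : ‖m‖ ^ 2 ≤ 2 * (∑ i, (m i - ϱ * d.U i) ^ 2) + 6 * ϱ ^ 2 * M ^ 2 := by
    rw [EuclideanSpace.real_norm_sq_eq]
    simp only [Fin.sum_univ_three]
    linarith [hmi 0, hmi 1, hmi 2]
  have hkin : ‖m‖ ^ 2 / (2 * ϱ) ≤ 2 * ((∑ i, (m i - ϱ * d.U i) ^ 2) / (2 * ϱ)) + 3 * M ^ 2 * ϱ := by
    rw [div_le_iff₀ (by positivity)]
    have e : (2 * ((∑ i, (m i - ϱ * d.U i) ^ 2) / (2 * ϱ)) + 3 * M ^ 2 * ϱ) * (2 * ϱ) =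
        2 * (∑ i, (m i - ϱ * d.U i) ^ 2) + 6 * ϱ ^ 2 * M ^ 2 := by
      field_simp
      ring
    rw [e]
    exact hm
  have hK0 : 0 ≤ (∑ i, (m i - ϱ * d.U i) ^ 2) / (2 * ϱ) := by positivity
  rw [hE]
  nlinarith [sq_nonneg M, hK0, hEi, hϱ.le]

/-- Rescaling a linear lower bound: `X ≤ NY` and `cY ≤ R` give `(c/N)X ≤ R` (`c ≥ 0`, `N > 0`). [folklore] -/
theorem scale_le {c N X Y R : ℝ} (hc : 0 ≤ c) (hN : 0 < N) (hXY : X ≤ N * Y) (h : c * Y ≤ R) :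
    c / N * X ≤ R := by
  have hN' : N ≠ 0 := hN.ne'
  calc c / N * X ≤ c / N * (N * Y) := mul_le_mul_of_nonneg_left hXY (div_nonneg hc hN.le)
    _ = c * Y := by field_simp
    _ ≤ R := h

/-- REGISTERED SUB-GOAL `stub_bf18ShellRHS` of the line `Sketch` (helper 3d of `stub_bf18Shell`): the pointwise
master step of the deterministic BF18 shell for admissible shell states `(ϱ, m, E)` of the monatomic excess class,
with the state-selected cut-off — `rawRHS + div(p̃U) ≤ C ℰ_Z`, `0 ≤ ℰ_Z`, near and far coercivity (module
docstring); cases vacuum / cold / warm. [cite: BrezinaFeireisl2018, §3.2.2] -/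
theorem stub_bf18ShellRHS : ∀ (χe f : ℝ → ℝ) (B : ℝ), ContDiffOn ℝ 2 χe (Set.Ioi 0) → ContDiffOn ℝ 2 f (Set.Ioi 0) →
    (∀ a, 0 < a → χe a = 1 + a * deriv f a) → (∀ a, 0 < a → 0 < χe a + a * deriv χe a) →
    (∀ a, 0 < a → |χe a| ≤ B) → ∀ (K : Set (ℝ × ℝ)), IsCompact K → K ⊆ Set.Ioi 0 ×ˢ Set.Ioi 0 →
    ∀ (M : ℝ), 0 ≤ M → ∃ δ a b C c : ℝ, 0 < δ ∧ a < b ∧ 0 < C ∧ 0 < c ∧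
    (∀ r Θ : ℝ, (r, Θ) ∈ K → δ < r ∧ δ < Θ) ∧
    (∀ r Θ ρ ϑ : ℝ, (r, Θ) ∈ K → |ρ - r| ≤ δ → |ϑ - Θ| ≤ δ →
      a ≤ (EulerEOS.monatomicExcess χe f).s ρ ϑ ∧ (EulerEOS.monatomicExcess χe f).s ρ ϑ ≤ b) ∧
    ∀ d : StrongPointData, (d.r, d.Θ) ∈ K → d.Bounded M → d.MassEq →
    d.TemperatureEq (EulerEOS.monatomicExcess χe f) → d.MomentumEq (EulerEOS.monatomicExcess χe f) →
    ∀ U : ℝ × EuclideanSpace ℝ (Fin 3) × ℝ, 0 ≤ U.1 → 0 ≤ U.2.2 → ‖U.2.1‖ ^ 2 ≤ 2 * U.1 * U.2.2 →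
    let eos := EulerEOS.monatomicExcess χe f;
    let w : EulerPhase := (U.1, U.2.2 - ‖U.2.1‖ ^ 2 / (2 * U.1), U.2.1);
    let Z : ℝ → ℝ := if 0 < 2 / 3 * (U.2.2 / U.1 - ‖U.2.1‖ ^ 2 / (2 * U.1 ^ 2)) then clamp a b else fun _ => a;
    rawRHS eos Z d w.1 w.2.1 w.2.2 + divPU eos d ≤ C * d.relEnergyZ eos Z w ∧ 0 ≤ d.relEnergyZ eos Z w ∧
    (0 < U.1 → |U.1 - d.r| ≤ δ → |stateTemp eos w.1 w.2.1 - d.Θ| ≤ δ →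
      c * ((U.1 - d.r) ^ 2 + (stateTemp eos w.1 w.2.1 - d.Θ) ^ 2) +
        (∑ i, (U.2.1 i - U.1 * d.U i) ^ 2) / (2 * U.1) ≤ d.relEnergyZ eos Z w) ∧
    (¬(0 < U.1 ∧ |U.1 - d.r| ≤ δ ∧ |stateTemp eos w.1 w.2.1 - d.Θ| ≤ δ) →
      c * (1 + U.1 + U.2.2 + (∑ i, (U.2.1 i - U.1 * d.U i) ^ 2) / (2 * U.1)) ≤ d.relEnergyZ eos Z w) := by
  intro χe f B hχ hf hvir hmono hB K hK hKq M hM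
  -- the equation-of-state facts of the monatomic excess class and the landed pointwise package
  obtain ⟨hG, hS, hp2, he2, hs2, he, htemp, hgrowth⟩ := monatomicExcess_bf_hypotheses χe f hχ hf hvir hmono hB
  obtain ⟨δ, a, b, C, c, hδ, hab, hC, hc, hKδ, hsab, hquad, hcold, hvac⟩ :=
    clamped_pointwise_package hG hS hp2 he2 hs2 he hgrowth (monatomicExcess_strong_growth hB)
      (monatomicExcess_p_pos hχ hmono hB) htemp monatomicExcess_p_cold monatomicExcess_p_vacuum hK hKq hM
  have hN : (0 : ℝ) < 3 + 3 * M ^ 2 := by positivity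
  have hN1 : (1 : ℝ) ≤ 3 + 3 * M ^ 2 := by nlinarith [sq_nonneg M]
  refine ⟨δ, a, b, C, c / (3 + 3 * M ^ 2), hδ, hab, hC, div_pos hc hN, hKδ, hsab, ?_⟩
  rintro d hdK hBd hmass hTeq hmom ⟨ϱ, m, E⟩ hϱ0 hE0 hadm
  dsimp only at hϱ0 hE0 hadm ⊢
  have hr : 0 < d.r := (hKq hdK).1
  have hΘ : 0 < d.Θ := (hKq hdK).2
  have hδΘ : δ < d.Θ := (hKδ d.r d.Θ hdK).2
  have hcN : c / (3 + 3 * M ^ 2) ≤ c := div_le_self hc.le hN1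
  -- the temperature of the phase point is the selector `2/3 (E/ϱ − ‖m‖²/(2ϱ²))`
  have hθo : stateTemp (monatomicExcess χe f) ϱ (E - ‖m‖ ^ 2 / (2 * ϱ)) =
      2 / 3 * (E / ϱ - ‖m‖ ^ 2 / (2 * ϱ ^ 2)) := stateTemp_shell ϱ E m
  generalize hZ : (if 0 < 2 / 3 * (E / ϱ - ‖m‖ ^ 2 / (2 * ϱ ^ 2)) then clamp a b else fun _ => a :
    ℝ → ℝ) = Z
  rcases hϱ0.lt_or_eq with hϱ | hϱ
  · -- positive density: `rawRHS + div(p̃U) = reducedRHS` (BF Step 1)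
    rw [divPU, rawRHS_add_div_eq (monatomicExcess χe f) Z d hϱ.ne' hr.ne' hmom]
    have hEi : E - ‖m‖ ^ 2 / (2 * ϱ) =
        3 / 2 * ϱ * stateTemp (monatomicExcess χe f) ϱ (E - ‖m‖ ^ 2 / (2 * ϱ)) := by
      rw [monatomicExcess_stateTemp]; field_simp
    have hEi0 : 0 ≤ E - ‖m‖ ^ 2 / (2 * ϱ) := by
      rw [sub_nonneg, div_le_iff₀ (by positivity)]; linarith
    by_cases hwarm : 0 < 2 / 3 * (E / ϱ - ‖m‖ ^ 2 / (2 * ϱ ^ 2))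
    · -- warm state: the cut-off is the clamp, the internal energy is positive
      rw [if_pos hwarm] at hZ
      subst hZ
      have hEpos : 0 < E - ‖m‖ ^ 2 / (2 * ϱ) := by
        rw [hEi]; rw [← hθo] at hwarm; positivity
      obtain ⟨h1, h2, h3, h4⟩ := hquad d hdK hBd ϱ (E - ‖m‖ ^ 2 / (2 * ϱ)) m hϱ hEpos
      refine ⟨h1 hmass hTeq, h2, fun _ hρδ hθδ => ?_, fun hfar => ?_⟩
      · have := h3 hρδ hθδ
        have hq : c / (3 + 3 * M ^ 2) *
            ((ϱ - d.r) ^ 2 + (stateTemp (monatomicExcess χe f) ϱ (E - ‖m‖ ^ 2 / (2 * ϱ)) - d.Θ) ^ 2) ≤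
            c * ((ϱ - d.r) ^ 2 + (stateTemp (monatomicExcess χe f) ϱ (E - ‖m‖ ^ 2 / (2 * ϱ)) - d.Θ) ^ 2) :=
          mul_le_mul_of_nonneg_right hcN (by positivity)
        linarith
      · have hfar' : ¬(|ϱ - d.r| ≤ δ ∧
            |stateTemp (monatomicExcess χe f) ϱ (E - ‖m‖ ^ 2 / (2 * ϱ)) - d.Θ| ≤ δ) :=
          fun h => hfar ⟨hϱ, h⟩
        exact scale_le hc.le hN (far_transfer hBd hϱ hEi0 m (by ring)) (h4 hfar')
    · -- cold state: the cut-off value is `a`, the internal energy vanishes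
      rw [if_neg hwarm] at hZ
      subst hZ
      have hE00 : E - ‖m‖ ^ 2 / (2 * ϱ) = 0 := by
        refine le_antisymm ?_ hEi0
        rw [hEi]; rw [← hθo] at hwarm
        have : stateTemp (monatomicExcess χe f) ϱ (E - ‖m‖ ^ 2 / (2 * ϱ)) ≤ 0 := not_lt.1 hwarm
        nlinarith
      have hE' : E = 0 + ‖m‖ ^ 2 / (2 * ϱ) := by linarith
      rw [hE00]
      obtain ⟨h1, h2⟩ := hcold d hdK hBd ϱ m hϱ
      have hK0 : 0 ≤ (∑ i, (m i - ϱ * d.U i) ^ 2) / (2 * ϱ) := by positivity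
      refine ⟨h1, le_trans (by positivity) h2, fun _ _ hθδ => ?_, fun _ => ?_⟩
      · -- a cold state is never `δ`-close to `K` (`ϑ = 0 < Θ − δ`)
        exfalso
        rw [monatomicExcess_stateTemp] at hθδ
        simp only [mul_zero, zero_div, zero_sub, abs_neg] at hθδ
        rw [abs_of_pos hΘ] at hθδ
        linarith
      · refine scale_le hc.le hN (far_transfer hBd hϱ le_rfl m hE') ?_
        simpa only [add_zero] using h2
  · -- the vacuum: no momentum by admissibility, `rawRHS + div(p̃U) = reducedRHS` by hand
    subst hϱ
    have hm0 : ‖m‖ ^ 2 = 0 := le_antisymm (by simpa using hadm) (sq_nonneg _)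
    have hm : m = 0 := norm_eq_zero.1 ((pow_eq_zero_iff two_ne_zero).1 hm0)
    subst hm
    simp only [norm_zero, mul_zero, div_zero, sub_zero, lt_self_iff_false, false_and, not_false_eq_true,
      IsEmpty.forall_iff, forall_const, true_and, add_zero]
    obtain ⟨h1, h2⟩ := hvac d hdK hBd E Z hE0
    have hid : rawRHS (monatomicExcess χe f) Z d 0 E 0 + divPU (monatomicExcess χe f) d =
        reducedRHS (monatomicExcess χe f) Z d 0 E 0 := by
      rw [reducedRHS_vacuum d Z E hr.ne' monatomicExcess_p_vacuum, divPU, rawRHS_vacuum]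
      ring
    refine ⟨hid ▸ h1, le_trans (by positivity) h2, ?_⟩
    have : c / (3 + 3 * M ^ 2) * (1 + E) ≤ c * (1 + E) := mul_le_mul_of_nonneg_right hcN (by positivity)
    exact this.trans h2

end Summit.AtomisticToContinuum.HydrodynamicLimit.Theorems.ChaosClosesEulerShellRHS

end
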